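import Summits.QuantumFields.BalabanUV.T4Continuum.Support.ScalarPlantingFaces

/-!
# G-an2-4 ∕ (CONV-C), road P2, route R2-S1 («intertwining census») — THE EXACT TWO-LEVEL DEFECT OF THE SCALAR LAPLACIAN AGAINST
# THE STAIRCASE INJECTION: `Δ′·J − J·Δ = Σ_μ ∂′_μᴴ( ∂′_μᴴ·π^L_μ·J·∂_μ + π^F_μ·J·∂_μᴴ∂_μ )` with DIAGONAL in-cell profiles
# `|π^L_μ|, |π^F_μ| ≤ (R−1)∕(RN) < η` — the algebraic identity behind the sup-norm one-step law of the soft minimiser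

Unit `b2b-balaban-gan24-p2` (gen 29), BINDER row G-an2-4 ∕ (CONV-C), road P2; crux team (2) under the coordinator ruling «YM REDIRECT».
Candidate route R2 of `beta/ROUTES-GAN24.md` hands road P2 the «S1 intertwining census»: how do Bałaban's one-step objects on the
`η`-lattice compare, POINTWISE, with the same objects on the `η/R`-lattice?  The operator-norm answer is the NE2 lane's
(`BalabanMinimizerLaw.opNorm_Mtil_succ_sub_le`, rate `L^{−k}` in `ℓ²`); the crux row's open substance (O-pos) is the POSITION-SPACE
(sup-norm) version for FINE-LEG constituents, for which the `ℓ²` law loses `η^{−d/2}`.  The road-P2 audit of gen 28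
(`HOME/b2b-balaban-gan24-p2/gen28/ROUTE-AUDIT-P2.md` §4) recorded the exact representation `M′v − J·Mv = −𝒢′(Δ′J − JΔ)Mv` of the
one-step difference of the soft minimiser `M = a′𝒢Q*` against King's staircase injection `J`, and that the naive bound of the defect
`Δ′J − JΔ` is `O(1)`, not `O(η)`.  THIS FILE proves the EXACT second-order structure of that defect, on the NE2 scalar carriers
`Tor (fine N M) ⊂ Tor (fine (R·N) M)` (`B5Action121.sdiff∕LapS`, `BalabanAveragedTowerModes.par`, `ScalarBlockPlanting.Qavg0`):

 * §1 index arithmetic of the backward step: `(x − e′_μ)_μ mod R`, «`x − e′_μ` on the far face ⟺ `x` on the near face»,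
   **`par_sub_unitVec`** (the twin of `BlockPairingGeometry.par_add_unitVec`);
 * §2 the plain staircase `stair = R^d·Q₀ᴴ` (`(stair u)(x′) = u(par x′)`), **`sdiff_mulVec_stair`** `∂′_μ(Ju) = R·𝟙_far·J(∂_μu)`,
   **`sdiffH_mulVec_stair`** `∂′_μᴴ(Jg) = R·𝟙_near·J(∂_μᴴg)`, and the Leibniz rule for `∂′ᴴ` against a diagonal profile;
 * §3 the in-cell profiles `π^L_μ(x′) = η′·(rem_μ x′ + 1)·[not far]`, `π^F_μ(x′) = −η′·(R − 1 − rem_μ x′)` (`η′ = (RN)⁻¹`), their sizes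
   `≤ (R−1)η′`, their backward derivatives `(RN)·(π^L(x′−e′) − π^L(x′)) = R·𝟙_far − 1`, `(RN)·(π^F(x′−e′) − π^F(x′)) = R·𝟙_near − 1`,
   and their vanishing behind the near face;
 * §4 **`laplacian_stair_defect_dir`** (one direction) and **`LapS_stair_defect`** (summed):
   `Δ′(Ju) − J(Δu) = Σ_μ ∂′_μᴴ( ∂′_μᴴ(π^L_μ·J(∂_μu)) + π^F_μ·J(∂_μᴴ∂_μu) )` — EXACT, every `d`, `N, R ≥ 1`, every torus `M`.

So the defect is a DIVERGENCE of fields of size `O(η)·(|∇u| under one more ∂′ᴴ, |∇ᴴ∇u|)`: applied through `𝒢′` it costs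
`‖𝒢′∂′ᴴ∂′ᴴ‖_{∞→∞}·η·|∂u|_∞ + ‖𝒢′∂′ᴴ‖_{∞→∞}·η·|∂ᴴ∂u|_∞` (file `GAN24/SoftMinimiserOneStepSup`), i.e. the sup-norm one-step law of the
soft minimiser follows from four sup quantities — two of them the (E2)∕(E3)-type entries of [B5] (1.115), two of them SECOND-ORDER
entries (`G∇*∇*` row sums, pure second differences of the minimiser) that carry at most a `log η⁻¹`.  The identity was checked in
exact rational arithmetic before typing (`numerics/check_identity.py`, `check_identity_2d.py` of the seat folder: residual 0 for
d = 1, 2 and all tested `(R, N)`).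

HONEST SCOPE.  Pure finite-lattice algebra (every declaration [folklore], kernel-checked, no `sorry`); scalar (0-form) layer, `U = 1`;
nothing of Bałaban's is asserted and nothing printed is used as a hypothesis (ABSOLUTE RULE).  Locators (text only): [Balaban1984PropagatorsI]
(1.115)–(1.117) p. 36 (the table the consumer file reduces to); [King1986] (2.10) p. 653 (the pairing `x′ ↦ par x′`).  NOT (CONV-C), NEVER
«G-an2-4 closed», NOT NE2, NOT D1, NOT BetaPertH, NOT continuum, NOT Clay; not in print — our bookkeeping.  HONEST DEPENDENCY: continuum YM
on T⁴ ⇐ BetaPertH ∧ nine spine estimates (0/9 proved); BetaPertH ⇐ (D1) ∧ (D4) ∧ CAP+tail; G-an2-4 gates asym, D1 and NE2/3/4.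
-/

noncomputable section

open scoped BigOperators ComplexConjugate Matrix

namespace Summit.QuantumFields.BalabanUV.Beta.GAN24.StaircaseLaplacianDefect

open Literature.MathematicalPhysics.QuantumFieldTheory.Balaban1983to89.B5Prop11Plancherel (Tor fine unitVec)
open Literature.MathematicalPhysics.QuantumFieldTheory.Balaban1983to89.B5Action121 (shiftS sdiff LapS sdiff_mulVec
  sdiff_conjTranspose_mulVec)
open Summit.QuantumFields.BalabanUV.T4Continuum.BalabanAveragedTowerModes (par val_par)
open Summit.QuantumFields.BalabanUV.T4Continuum.BlockPairingGeometry (par_add_unitVec)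
open Summit.QuantumFields.BalabanUV.T4Continuum.ScalarBlockPlanting (Qavg0 star_Qavg0_apply)

variable {d : ℕ}

section TwoLevel

variable (N R : ℕ) [NeZero N] [NeZero R] (M : Fin d → ℕ) [hM : ∀ μ, NeZero (M μ)]

/-! ## §1 Index arithmetic of the backward step -/

omit [NeZero N] [NeZero R] hM in
/-- `R` divides the fine period `R·N·M_μ`. [folklore] -/
theorem dvd_fine (μ : Fin d) : R ∣ fine (R * N) M μ := ⟨N * M μ, by simp only [fine]; ring⟩

omit [NeZero N] [NeZero R] hM in
/-- the `μ`-coordinate of `x − e′_μ` is `x_μ − 1`; the others are unchanged. [folklore] -/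
theorem sub_unitVec_apply_same (μ : Fin d) (x : Tor (fine (R * N) M)) :
    (x - unitVec (fine (R * N) M) μ) μ = x μ - 1 := by
  simp [unitVec]

/-- **the offset of the backward neighbour**: `x_μ mod R = ((x − e′_μ)_μ + 1) mod R` (as residues of the `ℕ`-values). [folklore] -/
theorem val_mod_eq_sub_unitVec (μ : Fin d) (x : Tor (fine (R * N) M)) :
    (x μ).val % R = (((x - unitVec (fine (R * N) M) μ) μ).val + 1) % R := by
  rw [sub_unitVec_apply_same]
  have hRP := dvd_fine N R M μ
  have h1 : x μ = (x μ - 1) + 1 := (sub_add_cancel _ _).symm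
  have h2 : (x μ).val = ((x μ - 1).val + (1 : ZMod (fine (R * N) M μ)).val) % fine (R * N) M μ := by
    conv_lhs => rw [h1]
    exact ZMod.val_add _ _
  rw [h2, Nat.mod_mod_of_dvd _ hRP, ZMod.val_one_eq_one_mod]
  rcases Nat.lt_or_ge 1 (fine (R * N) M μ) with hP | hP
  · rw [Nat.mod_eq_of_lt hP]
  · have hP1 : fine (R * N) M μ = 1 := le_antisymm hP (Nat.one_le_iff_ne_zero.mpr (NeZero.ne _))
    have hR1 : R = 1 := Nat.eq_one_of_dvd_one (hP1 ▸ hRP)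
    have hmod : ∀ a : ℕ, a % R = 0 := fun a => by rw [hR1, Nat.mod_one]
    rw [hmod, hmod]

/-- **`x − e′_μ` lies on the far `μ`-face iff `x` lies on the near `μ`-face** (`R ∣ (x − e′)_μ + 1 ⟺ R ∣ x_μ`). [folklore] -/
theorem far_sub_unitVec_iff (μ : Fin d) (x : Tor (fine (R * N) M)) :
    R ∣ ((x - unitVec (fine (R * N) M) μ) μ).val + 1 ↔ R ∣ (x μ).val := by
  rw [Nat.dvd_iff_mod_eq_zero, Nat.dvd_iff_mod_eq_zero, ← val_mod_eq_sub_unitVec]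

omit [NeZero N] hM in
/-- far face in terms of the offset: `R ∣ x_μ + 1 ⟺ x_μ mod R = R − 1`. [folklore] -/
theorem far_iff_mod (μ : Fin d) (x : Tor (fine (R * N) M)) : R ∣ (x μ).val + 1 ↔ (x μ).val % R = R - 1 := by
  have hR : 0 < R := Nat.pos_of_ne_zero (NeZero.ne R)
  have hr : (x μ).val % R < R := Nat.mod_lt _ hR
  rw [Nat.dvd_iff_mod_eq_zero, ← Nat.mod_add_mod]
  rcases Nat.lt_or_ge ((x μ).val % R + 1) R with h | h
  · rw [Nat.mod_eq_of_lt h]; omega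
  · have he : (x μ).val % R + 1 = R := le_antisymm hr h
    rw [he, Nat.mod_self]; omega

/-- **the offset of the backward neighbour, resolved**: `(x − e′_μ)_μ mod R = R − 1` if `x` is on the near face (`R ∣ x_μ`), and
`= x_μ mod R − 1` otherwise. [folklore] -/
theorem val_mod_sub_unitVec (μ : Fin d) (x : Tor (fine (R * N) M)) :
    ((x - unitVec (fine (R * N) M) μ) μ).val % R = if (x μ).val % R = 0 then R - 1 else (x μ).val % R - 1 := by
  have hR : 0 < R := Nat.pos_of_ne_zero (NeZero.ne R)
  have key := val_mod_eq_sub_unitVec N R M μ x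
  set s := ((x - unitVec (fine (R * N) M) μ) μ).val % R with hs
  have hsR : s < R := Nat.mod_lt _ hR
  have key' : (x μ).val % R = (s + 1) % R := by rw [key, hs, Nat.mod_add_mod]
  rcases Nat.lt_or_ge (s + 1) R with h | h
  · rw [Nat.mod_eq_of_lt h] at key'
    rw [if_neg (by omega)]; omega
  · have he : s + 1 = R := le_antisymm hsR h
    rw [he, Nat.mod_self] at key'
    rw [if_pos key']; omega

/-- **THE PARENT OF THE BACKWARD NEIGHBOUR**: `par(x − e′_μ) = par x − e_μ` if `x` lies on the near `μ`-face of its block (`R ∣ x_μ`),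
`= par x` otherwise (twin of `BlockPairingGeometry.par_add_unitVec`, torus wrap-around included). [cite: King1986, (2.10) p.653]
[folklore] -/
theorem par_sub_unitVec (μ : Fin d) (x : Tor (fine (R * N) M)) :
    par N R M (x - unitVec (fine (R * N) M) μ)
      = if R ∣ (x μ).val then par N R M x - unitVec (fine N M) μ else par N R M x := by
  have h := par_add_unitVec N R M μ (x - unitVec (fine (R * N) M) μ)
  rw [sub_add_cancel] at h
  by_cases hx : R ∣ (x μ).val
  · rw [if_pos ((far_sub_unitVec_iff N R M μ x).mpr hx)] at h
    rw [if_pos hx, h, add_sub_cancel_right]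
  · rw [if_neg (fun h' => hx ((far_sub_unitVec_iff N R M μ x).mp h'))] at h
    rw [if_neg hx, h]

/-! ## §2 The plain staircase and the first-order intertwinings -/

/-- the PLAIN STAIRCASE INJECTION `(stair)(x′, y) = [par x′ = y]` (piecewise-constant extension from the `η`-lattice to the
`η/R`-lattice; `= R^d·Q₀ᴴ = √(R^d)·J₀` in the notation of `ScalarBlockPlanting`). [cite: King1986, p.664] [folklore] -/
def stair : Matrix (Tor (fine (R * N) M)) (Tor (fine N M)) ℂ := fun x y => if par N R M x = y then 1 else 0

omit [NeZero N] hM in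
/-- `stair = R^d·Q₀ᴴ`. [folklore] -/
theorem stair_eq_smul_Qavg0H : stair N R M = ((R : ℂ) ^ d) • (Qavg0 N R M)ᴴ := by
  have hRc : ((R : ℂ) ^ d) ≠ 0 := pow_ne_zero _ (by exact_mod_cast NeZero.ne R)
  ext x y
  rw [Matrix.smul_apply, Matrix.conjTranspose_apply, star_Qavg0_apply, stair, Qavg0, smul_eq_mul]
  split_ifs with h
  · rw [mul_inv_cancel₀ hRc]
  · rw [mul_zero]

omit [NeZero R] in
/-- `(stair u)(x′) = u(par x′)`. [folklore] -/
theorem stair_mulVec (u : Tor (fine N M) → ℂ) (x : Tor (fine (R * N) M)) : (stair N R M *ᵥ u) x = u (par N R M x) := by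
  simp only [Matrix.mulVec, dotProduct, stair, ite_mul, one_mul, zero_mul, Finset.sum_ite_eq, Finset.mem_univ, if_true]

/-- **`∂′_μ(Ju) = R·𝟙_far·J(∂_μu)`**: a fine forward difference of a staircase lives on the far faces, where it is `R` times the coarse
difference (`∂′ = (RN)(S′ − 1)`, `∂ = N(S − 1)`). [cite: King1986, (2.10) p.653] [folklore] -/
theorem sdiff_mulVec_stair (μ : Fin d) (u : Tor (fine N M) → ℂ) (x : Tor (fine (R * N) M)) :
    (sdiff (fine (R * N) M) ((R * N : ℕ) : ℂ) μ *ᵥ (stair N R M *ᵥ u)) x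
      = (R : ℂ) * (if R ∣ (x μ).val + 1 then (sdiff (fine N M) ((N : ℕ) : ℂ) μ *ᵥ u) (par N R M x) else 0) := by
  rw [sdiff_mulVec, stair_mulVec, stair_mulVec, par_add_unitVec]
  split_ifs with h
  · rw [sdiff_mulVec]; push_cast; ring
  · push_cast; ring

/-- **`∂′_μᴴ(Jg) = R·𝟙_near·J(∂_μᴴg)`**: a fine backward difference of a staircase lives on the near faces. [folklore] -/
theorem sdiffH_mulVec_stair (μ : Fin d) (g : Tor (fine N M) → ℂ) (x : Tor (fine (R * N) M)) :
    ((sdiff (fine (R * N) M) ((R * N : ℕ) : ℂ) μ)ᴴ *ᵥ (stair N R M *ᵥ g)) x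
      = (R : ℂ) * (if R ∣ (x μ).val then ((sdiff (fine N M) ((N : ℕ) : ℂ) μ)ᴴ *ᵥ g) (par N R M x) else 0) := by
  rw [sdiff_conjTranspose_mulVec, stair_mulVec, stair_mulVec, par_sub_unitVec]
  split_ifs with h
  · rw [sdiff_conjTranspose_mulVec]; simp only [map_natCast]; push_cast; ring
  · simp only [map_natCast]; push_cast; ring

omit [NeZero N] [NeZero R] hM in
/-- Leibniz for the backward difference against a diagonal profile:
`∂ᴴ(π·g)(x) = c̄(π(x−e) − π(x))·g(x) + π(x−e)·(∂ᴴg)(x)`. [folklore] -/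
theorem sdiffH_mulVec_mul {Nf : Fin d → ℕ} [∀ μ, NeZero (Nf μ)] (c : ℂ) (μ : Fin d) (π g : Tor Nf → ℂ) :
    (sdiff Nf c μ)ᴴ *ᵥ (fun x => π x * g x)
      = fun x => conj c * (π (x - unitVec Nf μ) - π x) * g x + π (x - unitVec Nf μ) * ((sdiff Nf c μ)ᴴ *ᵥ g) x := by
  funext x
  rw [sdiff_conjTranspose_mulVec, sdiff_conjTranspose_mulVec]
  ring

/-! ## §3 The in-cell profiles -/

/-- the LAST-LAYER profile `π^L_μ(x′) = η′·(rem_μ x′ + 1)` off the far face, `0` on it (`η′ = (RN)⁻¹`). [folklore] -/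
def piL (μ : Fin d) (x : Tor (fine (R * N) M)) : ℂ :=
  if R ∣ (x μ).val + 1 then 0 else (((x μ).val % R + 1 : ℕ) : ℂ) / ((R * N : ℕ) : ℂ)

/-- the FIRST-LAYER profile `π^F_μ(x′) = −η′·(R − 1 − rem_μ x′)`. [folklore] -/
def piF (μ : Fin d) (x : Tor (fine (R * N) M)) : ℂ :=
  -((((R - 1 - (x μ).val % R : ℕ)) : ℂ) / ((R * N : ℕ) : ℂ))

omit hM in
/-- `|π^L| ≤ (R−1)∕(RN)`. [folklore] -/
theorem norm_piL_le (μ : Fin d) (x : Tor (fine (R * N) M)) : ‖piL N R M μ x‖ ≤ ((R : ℝ) - 1) / ((R : ℝ) * N) := by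
  have hR : 0 < R := Nat.pos_of_ne_zero (NeZero.ne R)
  have hN : 0 < N := Nat.pos_of_ne_zero (NeZero.ne N)
  have hRN : (0 : ℝ) < (R : ℝ) * N := by positivity
  have hR1 : (1 : ℝ) ≤ R := by exact_mod_cast hR
  unfold piL
  split_ifs with h
  · rw [norm_zero]; exact div_nonneg (by linarith) hRN.le
  · have hr : (x μ).val % R < R := Nat.mod_lt _ hR
    have hne : (x μ).val % R ≠ R - 1 := fun he => h ((far_iff_mod N R M μ x).mpr he)
    have hle : ((x μ).val % R + 1 : ℕ) ≤ R - 1 := by omega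
    have hcast : (((x μ).val % R : ℕ) : ℝ) + 1 ≤ (R : ℝ) - 1 := by
      have := (Nat.cast_le (α := ℝ)).mpr hle
      rw [Nat.cast_sub hR] at this; push_cast at this; linarith
    rw [norm_div, Complex.norm_natCast, Complex.norm_natCast]; push_cast
    exact div_le_div_of_nonneg_right hcast hRN.le

omit hM in
/-- `|π^F| ≤ (R−1)∕(RN)`. [folklore] -/
theorem norm_piF_le (μ : Fin d) (x : Tor (fine (R * N) M)) : ‖piF N R M μ x‖ ≤ ((R : ℝ) - 1) / ((R : ℝ) * N) := by
  have hR : 0 < R := Nat.pos_of_ne_zero (NeZero.ne R)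
  have hN : 0 < N := Nat.pos_of_ne_zero (NeZero.ne N)
  have hRN : (0 : ℝ) < (R : ℝ) * N := by positivity
  have hle : (R - 1 - (x μ).val % R : ℕ) ≤ R - 1 := Nat.sub_le _ _
  have hcast : (((R - 1 - (x μ).val % R : ℕ)) : ℝ) ≤ (R : ℝ) - 1 := by
    have := (Nat.cast_le (α := ℝ)).mpr hle
    rw [Nat.cast_sub hR] at this; push_cast at this; linarith
  unfold piF
  rw [norm_neg, norm_div, Complex.norm_natCast, Complex.norm_natCast]; push_cast
  exact div_le_div_of_nonneg_right hcast hRN.le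

/-- **the backward derivative of `π^L`**: `(RN)·(π^L(x′−e′_μ) − π^L(x′)) = R·𝟙_far(x′) − 1`. [folklore] -/
theorem dpiL (μ : Fin d) (x : Tor (fine (R * N) M)) :
    conj ((R * N : ℕ) : ℂ) * (piL N R M μ (x - unitVec (fine (R * N) M) μ) - piL N R M μ x)
      = (R : ℂ) * (if R ∣ (x μ).val + 1 then 1 else 0) - 1 := by
  have hR : 0 < R := Nat.pos_of_ne_zero (NeZero.ne R)
  have hN : 0 < N := Nat.pos_of_ne_zero (NeZero.ne N)
  have hRNc : ((R * N : ℕ) : ℂ) ≠ 0 := by exact_mod_cast (Nat.mul_pos hR hN).ne'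
  have hr : (x μ).val % R < R := Nat.mod_lt _ hR
  have hfar := far_iff_mod N R M μ x
  have hfar' := far_sub_unitVec_iff N R M μ x
  have hs := val_mod_sub_unitVec N R M μ x
  rw [map_natCast]
  unfold piL
  rw [hs]
  by_cases hx : R ∣ (x μ).val + 1
  · -- `x` on the far face: `r = R − 1`
    have hrR : (x μ).val % R = R - 1 := hfar.mp hx
    rw [if_pos hx, if_pos hx]
    by_cases hR1 : R = 1
    · -- then every site is also on the near face and `π^L ≡ 0`
      have h0 : (x μ).val % R = 0 := by rw [hrR]; omega
      have hnear : R ∣ (x μ).val := Nat.dvd_iff_mod_eq_zero.mpr h0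
      rw [if_pos (hfar'.mpr hnear), sub_self, mul_zero]
      simp [hR1]
    · have hnear : ¬ R ∣ (x μ).val := by
        rw [Nat.dvd_iff_mod_eq_zero, hrR]; omega
      rw [if_neg (fun h' => hnear (hfar'.mp h')), if_neg (by rw [hrR]; omega), hrR]
      have e : (R - 1 - 1 + 1 : ℕ) = R - 1 := by omega
      rw [e]; field_simp; push_cast [Nat.cast_sub hR]; ring
  · have hrR : (x μ).val % R ≠ R - 1 := fun he => hx (hfar.mpr he)
    rw [if_neg hx, if_neg hx]
    by_cases hnear : R ∣ (x μ).val
    · have hr0 : (x μ).val % R = 0 := Nat.dvd_iff_mod_eq_zero.mp hnear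
      rw [if_pos (hfar'.mpr hnear), hr0]
      field_simp; push_cast; ring
    · have hr0 : (x μ).val % R ≠ 0 := fun he => hnear (Nat.dvd_iff_mod_eq_zero.mpr he)
      rw [if_neg (fun h' => hnear (hfar'.mp h')), if_neg hr0]
      have e : ((x μ).val % R - 1 + 1 : ℕ) = (x μ).val % R := by omega
      rw [e]; field_simp; push_cast; ring

/-- **the backward derivative of `π^F`**: `(RN)·(π^F(x′−e′_μ) − π^F(x′)) = R·𝟙_near(x′) − 1`. [folklore] -/
theorem dpiF (μ : Fin d) (x : Tor (fine (R * N) M)) :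
    conj ((R * N : ℕ) : ℂ) * (piF N R M μ (x - unitVec (fine (R * N) M) μ) - piF N R M μ x)
      = (R : ℂ) * (if R ∣ (x μ).val then 1 else 0) - 1 := by
  have hR : 0 < R := Nat.pos_of_ne_zero (NeZero.ne R)
  have hN : 0 < N := Nat.pos_of_ne_zero (NeZero.ne N)
  have hRNc : ((R * N : ℕ) : ℂ) ≠ 0 := by exact_mod_cast (Nat.mul_pos hR hN).ne'
  have hr : (x μ).val % R < R := Nat.mod_lt _ hR
  have hs := val_mod_sub_unitVec N R M μ x
  rw [map_natCast]
  unfold piF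
  rw [hs]
  by_cases hnear : R ∣ (x μ).val
  · have hr0 : (x μ).val % R = 0 := Nat.dvd_iff_mod_eq_zero.mp hnear
    rw [if_pos hr0, if_pos hnear, hr0, Nat.sub_self, Nat.sub_zero]
    field_simp; push_cast [Nat.cast_sub hR]; ring
  · have hr0 : (x μ).val % R ≠ 0 := fun he => hnear (Nat.dvd_iff_mod_eq_zero.mpr he)
    rw [if_neg hr0, if_neg hnear]
    have h1 : 1 ≤ (x μ).val % R := Nat.one_le_iff_ne_zero.mpr hr0
    have e1 : (R - 1 - ((x μ).val % R - 1) : ℕ) = R - (x μ).val % R := by omega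
    rw [e1]
    field_simp
    rw [Nat.cast_sub hr.le, Nat.cast_sub (by omega : (x μ).val % R ≤ R - 1), Nat.cast_sub hR]
    push_cast; ring

/-- behind the near face `π^L` vanishes: `R ∣ x_μ ⟹ π^L(x − e′_μ) = 0` (`x − e′_μ` is on the far face). [folklore] -/
theorem piL_sub_of_near (μ : Fin d) (x : Tor (fine (R * N) M)) (hx : R ∣ (x μ).val) :
    piL N R M μ (x - unitVec (fine (R * N) M) μ) = 0 := by
  unfold piL; rw [if_pos ((far_sub_unitVec_iff N R M μ x).mpr hx)]

/-- behind the near face `π^F` vanishes: `R ∣ x_μ ⟹ π^F(x − e′_μ) = 0`. [folklore] -/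
theorem piF_sub_of_near (μ : Fin d) (x : Tor (fine (R * N) M)) (hx : R ∣ (x μ).val) :
    piF N R M μ (x - unitVec (fine (R * N) M) μ) = 0 := by
  have hr0 : (x μ).val % R = 0 := Nat.dvd_iff_mod_eq_zero.mp hx
  unfold piF
  rw [val_mod_sub_unitVec, if_pos hr0, Nat.sub_self]
  simp

/-! ## §4 The exact second-order structure of the defect `Δ′J − JΔ` -/

/-- the inner bracket, first half: `∂′_μᴴ(π^L_μ·J(∂_μu)) = R·𝟙_far·J(∂_μu) − J(∂_μu) = ∂′_μ(Ju) − J(∂_μu)`. [folklore] -/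
theorem sdiffH_piL_stair (μ : Fin d) (u : Tor (fine N M) → ℂ) (x : Tor (fine (R * N) M)) :
    ((sdiff (fine (R * N) M) ((R * N : ℕ) : ℂ) μ)ᴴ *ᵥ
        (fun z => piL N R M μ z * (stair N R M *ᵥ (sdiff (fine N M) ((N : ℕ) : ℂ) μ *ᵥ u)) z)) x
      = (sdiff (fine (R * N) M) ((R * N : ℕ) : ℂ) μ *ᵥ (stair N R M *ᵥ u)) x
        - (stair N R M *ᵥ (sdiff (fine N M) ((N : ℕ) : ℂ) μ *ᵥ u)) x := by
  rw [sdiffH_mulVec_mul]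
  dsimp only
  rw [dpiL, sdiffH_mulVec_stair, sdiff_mulVec_stair, stair_mulVec]
  by_cases hnear : R ∣ (x μ).val
  · rw [piL_sub_of_near N R M μ x hnear]
    split_ifs <;> ring
  · rw [if_neg hnear]
    split_ifs <;> ring

/-- the inner bracket, second half: `∂′_μᴴ(π^F_μ·J(∂_μᴴ∂_μu)) = (R·𝟙_near − 1)·J(∂_μᴴ∂_μu)`. [folklore] -/
theorem sdiffH_piF_stair (μ : Fin d) (u : Tor (fine N M) → ℂ) (x : Tor (fine (R * N) M)) :
    ((sdiff (fine (R * N) M) ((R * N : ℕ) : ℂ) μ)ᴴ *ᵥ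
        (fun z => piF N R M μ z *
          (stair N R M *ᵥ ((sdiff (fine N M) ((N : ℕ) : ℂ) μ)ᴴ *ᵥ (sdiff (fine N M) ((N : ℕ) : ℂ) μ *ᵥ u))) z)) x
      = ((R : ℂ) * (if R ∣ (x μ).val then 1 else 0) - 1) *
          ((sdiff (fine N M) ((N : ℕ) : ℂ) μ)ᴴ *ᵥ (sdiff (fine N M) ((N : ℕ) : ℂ) μ *ᵥ u)) (par N R M x) := by
  rw [sdiffH_mulVec_mul]
  dsimp only
  rw [dpiF, sdiffH_mulVec_stair, stair_mulVec]
  by_cases hnear : R ∣ (x μ).val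
  · rw [piF_sub_of_near N R M μ x hnear]; ring
  · rw [if_neg hnear, if_neg hnear]; ring

/-- **THE DEFECT IN ONE DIRECTION, EXACTLY**:
`∂′_μᴴ∂′_μ(Ju) − J(∂_μᴴ∂_μu) = ∂′_μᴴ( ∂′_μᴴ(π^L_μ·J(∂_μu)) + π^F_μ·J(∂_μᴴ∂_μu) )`. [folklore] -/
theorem laplacian_stair_defect_dir (μ : Fin d) (u : Tor (fine N M) → ℂ) :
    (sdiff (fine (R * N) M) ((R * N : ℕ) : ℂ) μ)ᴴ *ᵥ (sdiff (fine (R * N) M) ((R * N : ℕ) : ℂ) μ *ᵥ (stair N R M *ᵥ u))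
        - stair N R M *ᵥ ((sdiff (fine N M) ((N : ℕ) : ℂ) μ)ᴴ *ᵥ (sdiff (fine N M) ((N : ℕ) : ℂ) μ *ᵥ u))
      = (sdiff (fine (R * N) M) ((R * N : ℕ) : ℂ) μ)ᴴ *ᵥ
          (((sdiff (fine (R * N) M) ((R * N : ℕ) : ℂ) μ)ᴴ *ᵥ
              (fun z => piL N R M μ z * (stair N R M *ᵥ (sdiff (fine N M) ((N : ℕ) : ℂ) μ *ᵥ u)) z))
            + (fun z => piF N R M μ z *
                (stair N R M *ᵥ ((sdiff (fine N M) ((N : ℕ) : ℂ) μ)ᴴ *ᵥ (sdiff (fine N M) ((N : ℕ) : ℂ) μ *ᵥ u))) z)) := by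
  -- the first inner bracket is `∂′(Ju) − J(∂u)` as a function
  have hA : ((sdiff (fine (R * N) M) ((R * N : ℕ) : ℂ) μ)ᴴ *ᵥ
        fun z => piL N R M μ z * (stair N R M *ᵥ (sdiff (fine N M) ((N : ℕ) : ℂ) μ *ᵥ u)) z)
      = sdiff (fine (R * N) M) ((R * N : ℕ) : ℂ) μ *ᵥ (stair N R M *ᵥ u)
          - stair N R M *ᵥ (sdiff (fine N M) ((N : ℕ) : ℂ) μ *ᵥ u) := by
    funext x; rw [Pi.sub_apply]; exact sdiffH_piL_stair N R M μ u x
  rw [Matrix.mulVec_add, hA, Matrix.mulVec_sub]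
  funext x
  rw [Pi.sub_apply, Pi.add_apply, Pi.sub_apply, sdiffH_piF_stair, sdiffH_mulVec_stair, stair_mulVec]
  split_ifs <;> ring

/-- **THE DEFECT OF THE LAPLACIAN AGAINST THE STAIRCASE, EXACTLY** (`Δ = Σ_μ ∂_μᴴ∂_μ` with lattice factors `RN` and `N`):
`Δ′(Ju) − J(Δu) = Σ_μ ∂′_μᴴ( ∂′_μᴴ(π^L_μ·J(∂_μu)) + π^F_μ·J(∂_μᴴ∂_μu) )`. [folklore] -/
theorem LapS_stair_defect (u : Tor (fine N M) → ℂ) :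
    LapS (fine (R * N) M) ((R * N : ℕ) : ℂ) *ᵥ (stair N R M *ᵥ u) - stair N R M *ᵥ (LapS (fine N M) ((N : ℕ) : ℂ) *ᵥ u)
      = ∑ μ, (sdiff (fine (R * N) M) ((R * N : ℕ) : ℂ) μ)ᴴ *ᵥ
          (((sdiff (fine (R * N) M) ((R * N : ℕ) : ℂ) μ)ᴴ *ᵥ
              (fun z => piL N R M μ z * (stair N R M *ᵥ (sdiff (fine N M) ((N : ℕ) : ℂ) μ *ᵥ u)) z))
            + (fun z => piF N R M μ z *
                (stair N R M *ᵥ ((sdiff (fine N M) ((N : ℕ) : ℂ) μ)ᴴ *ᵥ (sdiff (fine N M) ((N : ℕ) : ℂ) μ *ᵥ u))) z)) := by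
  have e1 : LapS (fine (R * N) M) ((R * N : ℕ) : ℂ) *ᵥ (stair N R M *ᵥ u)
      = ∑ μ, (sdiff (fine (R * N) M) ((R * N : ℕ) : ℂ) μ)ᴴ *ᵥ
          (sdiff (fine (R * N) M) ((R * N : ℕ) : ℂ) μ *ᵥ (stair N R M *ᵥ u)) := by
    rw [LapS, Matrix.sum_mulVec]
    exact Finset.sum_congr rfl fun μ _ => by rw [← Matrix.mulVec_mulVec]
  have e2 : stair N R M *ᵥ (LapS (fine N M) ((N : ℕ) : ℂ) *ᵥ u)
      = ∑ μ, stair N R M *ᵥ ((sdiff (fine N M) ((N : ℕ) : ℂ) μ)ᴴ *ᵥ (sdiff (fine N M) ((N : ℕ) : ℂ) μ *ᵥ u)) := by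
    rw [LapS, Matrix.sum_mulVec, Matrix.mulVec_sum]
    exact Finset.sum_congr rfl fun μ _ => by rw [← Matrix.mulVec_mulVec]
  rw [e1, e2, ← Finset.sum_sub_distrib]
  exact Finset.sum_congr rfl fun μ _ => laplacian_stair_defect_dir N R M μ u

end TwoLevel

end Summit.QuantumFields.BalabanUV.Beta.GAN24.StaircaseLaplacianDefect

end
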